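import Literature.NumberTheory.Rogawski1990.UnitStableOrbitalIntegralHSideCount            -- ★ p840679 (L5) HEAD SKELETON
import Literature.NumberTheory.Rogawski1990.UnitOrbitalIntegralInertClosedForms             -- ★ p840568 A-p03: `Flicker1998.phiH`
import Literature.NumberTheory.Rogawski1990.LocalStableClassesNonsplitRankTwo             -- ★ p840657 (L5-e) A-p13: the two classes
import Literature.NumberTheory.Automorphic.UnitOrbitalIntegralFixedPointsPair             -- ★ p840404 (L2)-PAIR socket
import Literature.NumberTheory.Automorphic.UnitaryUnitOrbitalIntegralLatticeCount         -- ★ lattice-count socket §2–§3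
import Literature.NumberTheory.Automorphic.SelfDualLatticeCountFrameTransportCM           -- ★-bound (L5-d1) FILE B A-p13: frame transport at `w`, parity flip
import Literature.NumberTheory.Automorphic.SelfDualStableLatticeCountNormalized           -- ★ p840741 (L5-d3): the normalised count
import Literature.NumberTheory.LocalFields.UnramifiedQuadraticNormAtInertPlace           -- ★ inert instance block (`σ_w` moves an integer by a unit, `|𝓀_w| = q²`)
import Literature.NumberTheory.Automorphic.ValuedFieldValuativeRelBridge                  -- ★ `isUniformizingElement_of_v_eq`, `v_eq_one_iff_valuation_eq_one`
import Literature.NumberTheory.Automorphic.LocalRegularOrbitClosed                        -- ★ `map_conjLocal_transpose_localForm`, `isUnit_det_localForm`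
import Literature.NumberTheory.Rogawski1990.U3SupercuspidalJacquetVanishing               -- ★ `coe_localNonsplitEquiv_apply`
import Literature.NumberTheory.Rogawski1990.ExplicitFactorKappaAlmostEverywhereOne        -- ★ `conjLocal_apply_eq_galAdicCompletionMap`
import Literature.NumberTheory.Automorphic.UnitaryGroupIntegralPointsReductionInert       -- ★ `valuation_galAdicCompletionMap_eq`, `natCard_residueField_eq_sq_of_inert`
import Literature.NumberTheory.Automorphic.Liu2021.LemD1AsPrintedIndexedNonVacuityInertCofinite -- ★ `valued_toPlace_uniformizer_of_isUnramifiedIn`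
import Literature.NumberTheory.Automorphic.UnitaryGroupInertPlaceHyperbolicBasis          -- ★ `galAdicCompletionMap_galAdicCompletionMap_of_smul_eq`
import HarnessLib

/-!
# The H-side VALUE of the inert unit fundamental lemma for `U(3)`: `Φ^st(γ_H, 1_{K_H}) = (q^N(q+1) − 2)∕(q − 1)` (Flicker 1998, §6 p. 95)

Topic `NumberTheory/Rogawski1990`; namespace `Literature.NumberTheory.Rogawski1990` (plumbing in `Literature.NumberTheory.Automorphic.UnitaryGroup`).  THEOREMS ONLY
(no definition, no instance, no notation, no named fact, no `sorry`).  Cell `pub/hodgecm-mathlib`, F0∕P3a road «D-N7-inert» ∕ MAP v3 (F9), the FINAL file of (L5)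
(B-p10 (g24), integrator; LEAD F0P3a-plan (g9) T8-35 (C) ∕ T8-40 ∕ T8-41).  HC_CM is proved only modulo the printed citations until rung 0 closes; nothing printed is a letter
here — every input is ★: the HEAD SKELETON ★ p840679, the two classes ★ (L5-e) p840657 (A-p13), the (L2)-PAIR socket ★ p840404, the lattice-count socket ★
`UnitaryUnitOrbitalIntegralLatticeCount`, the frame transport ★ (L5-d1) (A-p13), the normalised count ★ (L5-d3) p840741 over ★ (L5-a) p840624 ∕ ★ (L5-b) p840702 (B-p04) ∕
★ (L5-c) p840580–p840590, and the gluing sum ★ (L5-d2) p840632.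

THE PRINT [Flicker1998UnitaryFL, §6 p. 95]: for `t₀ = (a, b, c)` with `γ₂ = (a, c)` elliptic regular in `U(1,1)` at a non-split unramified `v`, `N = v_w(a − c)`:
«`Φ^st_{1_{K_H}}(t₀) = Φ_H(t₁) + Φ_H(t₂) = (q^N(q+1) − 2)∕(q − 1)`».

* §1 ONE-PLACE TRANSPORT (CM carriers `E_v = Π_{w∣v} L_w` → `L_w`): `twistGram` read at `w`, eigenframes read at `w`.
* §2 THE PER-CLASS VALUE `exists_classOrbitalIntegral_indicator_eq_paritySum`: for `δ ∈ U(Φ₂)_v` with eigenframe `δ Q = Q diag(u)` on the CM carrier, `Z(δ)` compact and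
  `(δ, γ₁)` `G`-regular: `Φ(⟦(δ, γ₁)⟧, 1_{K₂ ×ˢ K₁}) = Σ_{j ≤ N, j ≡ e} w(j)` for an `e ∈ {0,1}` whose parity is that of the order of `⟨q₀, q₀⟩` at `w`.
* §3 HEAD **`stableOrbitalIntegralRel_indicator_eq_flicker_of_eigenframe`** — the displayed value; **`…_eq_phiH_of_eigenframe`** — the same in the
  «N7nsCount» assembly contract's currency `((Flicker1998.phiH (Ideal.absNorm v.asIdeal) N : ℚ) : ℂ)` (A-p06 SPEC-F12 (S1)).

## References
* [Flicker1998UnitaryFL] Y. Z. Flicker, *Elementary proof of the fundamental lemma for a unitary group*, Canad. J. Math. 50 (1998), §6 p. 95 and REMARK.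
* [Rogawski1990] J. D. Rogawski, *Automorphic Representations of Unitary Groups in Three Variables* (1990), §4.9 Prop. 4.9.1 (b) p. 55, Lemma 4.9.3 p. 56.
* [Kottwitz1986] R. E. Kottwitz, *Stable trace formula: elliptic singular terms*, Math. Ann. 275 (1986), §3.
-/

set_option autoImplicit false

noncomputable section

open MeasureTheory NumberField IsDedekindDomain Matrix Finset ValuativeRel
open scoped ValuativeRel Matrix MatrixGroups

namespace Literature.NumberTheory.Automorphic.UnitaryGroup

open Literature.NumberTheory.Rogawski1990

variable (L : Type) [Field L] [NumberField L] [IsCMField L] (v : HeightOneSpectrum (𝓞 ↥(maximalRealSubfield L)))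
  (w : PlacesOver L v) (hw : IsCMField.complexConj L • w.1 = w.1)

/-! ## §1 One-place transport: `twistGram` and eigenframes read at `w` -/

section Transport

include hw in
/-- **`twistGram` read at `w`**: `(ᵗ(σ_v X) H X)ᵢⱼ(w) = (ᵗ(σ_w X_w) H_w X_w)ᵢⱼ` (`(c ⊗ 1)(x)_w = σ_w(x_w)`, ★ `conjLocal_apply_eq_galAdicCompletionMap`). [cite: PlatonovRapinchuk1994, §5.1] -/
theorem twistGram_apply_eval {n : ℕ} (H X : Matrix (Fin n) (Fin n) (LocalRing L v)) (i j : Fin n) :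
    twistGram (conjLocal L (IsCMField.complexConj L) v) H X i j w =
      twistGram (galAdicCompletionMap (L := L) (IsCMField.complexConj L) hw)
        (H.map (Pi.evalRingHom (fun w' : PlacesOver L v => w'.1.adicCompletion L) w))
        (X.map (Pi.evalRingHom (fun w' : PlacesOver L v => w'.1.adicCompletion L) w)) i j := by
  set f := Pi.evalRingHom (fun w' : PlacesOver L v => w'.1.adicCompletion L) w with hf
  have hσ : (X.map (conjLocal L (IsCMField.complexConj L) v)).map f = (X.map f).map (galAdicCompletionMap (L := L) (IsCMField.complexConj L) hw) := by
    refine Matrix.ext fun a b => ?_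
    simp only [Matrix.map_apply, hf, Pi.evalRingHom_apply]
    exact conjLocal_apply_eq_galAdicCompletionMap L v w hw (X a b)
  have h : (twistGram (conjLocal L (IsCMField.complexConj L) v) H X).map f =
      twistGram (galAdicCompletionMap (L := L) (IsCMField.complexConj L) hw) (H.map f) (X.map f) := by
    rw [twistGram_def, twistGram_def, Matrix.map_mul, Matrix.map_mul, Matrix.transpose_map, hσ]
  have := congrFun (congrFun h i) j
  rw [Matrix.map_apply] at this
  exact this

omit [IsCMField L] in
/-- **Eigenframes read at `w`**: `γ Q = Q · diag(u)` on `E_v` gives `γ_w Q_w = Q_w · diag(u_w)` on `L_w`. [cite: PlatonovRapinchuk1994, §5.1] -/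
theorem map_eval_mul_eq_of_eigenframe {n : ℕ} {γ Q : Matrix (Fin n) (Fin n) (LocalRing L v)} {u : Fin n → LocalRing L v} (hQ : γ * Q = Q * diagonal u) :
    γ.map (Pi.evalRingHom (fun w' : PlacesOver L v => w'.1.adicCompletion L) w) * Q.map (Pi.evalRingHom (fun w' : PlacesOver L v => w'.1.adicCompletion L) w) =
      Q.map (Pi.evalRingHom (fun w' : PlacesOver L v => w'.1.adicCompletion L) w) * diagonal fun i => u i w := by
  have h := congrArg (fun M : Matrix (Fin n) (Fin n) (LocalRing L v) => M.map (Pi.evalRingHom (fun w' : PlacesOver L v => w'.1.adicCompletion L) w)) hQ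
  simp only [Matrix.map_mul] at h
  rw [h, Matrix.diagonal_map (map_zero _)]
  rfl

include hw in
/-- **Eigenvalues read at `w` stay distinct** (non-split: `x = y ↔ x_w = y_w`, ★ `LocalRing.eq_iff_apply_eq`) **and of norm one** (`σ_w(u_w) u_w = 1`).
[cite: PlatonovRapinchuk1994, §5.1] -/
theorem injective_eval_and_norm_one_of_eigenvalues {n : ℕ} {u : Fin n → LocalRing L v} (hu : Function.Injective u)
    (hu1 : ∀ i, conjLocal L (IsCMField.complexConj L) v (u i) * u i = 1) :
    Function.Injective (fun i => u i w) ∧ ∀ i, galAdicCompletionMap (L := L) (IsCMField.complexConj L) hw (u i w) * u i w = 1 := by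
  have hc1 : IsCMField.complexConj L ≠ 1 := IsCMField.complexConj_ne_one L
  refine ⟨fun i j hij => hu ((LocalRing.eq_iff_apply_eq (IsCMField.complexConj L) hc1 w hw (u i) (u j)).2 hij), fun i => ?_⟩
  have h := congrArg (fun x : LocalRing L v => x w) (hu1 i)
  simp only [Pi.mul_apply, Pi.one_apply] at h
  rwa [conjLocal_apply_eq_galAdicCompletionMap L v w hw (u i)] at h

end Transport

/-! ## §2 The lattice count of ONE class at `w`, and the normalised count at `w` -/

section OneClass

include hw in
/-- A norm-one element of `L_w` has valuation one: `σ_w(x) x = 1`, `|σ_w x| = |x|`. [cite: CasselsFrohlichANT1967, Ch. VII §1.1] -/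
theorem valuation_eq_one_of_galAdicCompletionMap_mul_self {x : w.1.adicCompletion L}
    (hx : galAdicCompletionMap (L := L) (IsCMField.complexConj L) hw x * x = 1) : valuation (w.1.adicCompletion L) x = 1 := by
  have h := congrArg (valuation (w.1.adicCompletion L)) hx
  rw [map_mul, map_one, valuation_galAdicCompletionMap_eq (IsCMField.complexConj L) v w hw x] at h
  rcases lt_trichotomy (valuation (w.1.adicCompletion L) x) 1 with hlt | heq | hgt
  · exact absurd h (mul_lt_one' hlt hlt).ne
  · exact heq
  · exact absurd h (one_lt_mul'' hgt hgt).ne'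

include hw in
/-- **`#Fix_δ(U(Φ₂)_v ⧸ K₂) = #S((Φ₂)_w, δ_w)`** — ★ lattice-count socket §2 + §3 at `N := 2`, `H := Φ₂` (hyperspecial everywhere), `v` unramified in `L`.
[cite: Kottwitz1986, §3] [cite: Rogawski1990, §4.9 Prop. 4.9.1 (b) p. 55] -/
theorem natCard_fixedBy_eq_ncard_selfDualStable_antidiagTwo (hv : Algebra.IsUnramifiedIn (𝓞 L) v.asIdeal)
    (δ : (cmDatum L 2 (Matrix.of fun i j : Fin 2 => if i.val + j.val + 1 = 2 then (1 : L) else 0)).Local v) :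
    Nat.card (MulAction.fixedBy ((cmDatum L 2 (Matrix.of fun i j : Fin 2 => if i.val + j.val + 1 = 2 then (1 : L) else 0)).Local v ⧸
        cmLocalIntegralLevel L 2 (Matrix.of fun i j : Fin 2 => if i.val + j.val + 1 = 2 then (1 : L) else 0) v) δ) =
      {Λ : Submodule 𝒪[w.1.adicCompletion L] (Fin 2 → w.1.adicCompletion L) |
        (∃ g : GL (Fin 2) (w.1.adicCompletion L),
          (∃ J' ∈ glInt 2 (w.1.adicCompletion L), (J' : Matrix (Fin 2) (Fin 2) (w.1.adicCompletion L)) =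
            formCongr (galAdicCompletionMap (L := L) (IsCMField.complexConj L) hw) g
              (placeForm (Matrix.of fun i j : Fin 2 => if i.val + j.val + 1 = 2 then (1 : L) else 0) w.1)) ∧
          Λ = Submodule.span 𝒪[w.1.adicCompletion L] (Set.range ((g : Matrix (Fin 2) (Fin 2) (w.1.adicCompletion L)))ᵀ)) ∧
        Λ.map ((Matrix.toLin' (((localNonsplitEquiv (IsCMField.complexConj L)
            (Matrix.of fun i j : Fin 2 => if i.val + j.val + 1 = 2 then (1 : L) else 0) (IsCMField.complexConj_ne_one L) w hw δ :
            unitaryGroupOfForm (galAdicCompletionMap (L := L) (IsCMField.complexConj L) hw)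
              (placeForm (Matrix.of fun i j : Fin 2 => if i.val + j.val + 1 = 2 then (1 : L) else 0) w.1)) :
              GL (Fin 2) (w.1.adicCompletion L)) : Matrix (Fin 2) (Fin 2) (w.1.adicCompletion L))).restrictScalars 𝒪[w.1.adicCompletion L]) = Λ}.ncard := by
  rw [natCard_fixedBy_cmLocalIntegralLevel_eq_ncard_of_smul_eq L 2 _ (IsCMField.complexConj_ne_one L) w hw
    (isUnit_placeForm_antidiagOne (E := L) 2 w.1) δ]
  congr 1
  ext Λ
  simp only [Set.mem_setOf_eq]
  rw [exists_mem_unitary_span_eq_iff_selfDual_of_nonsplit L 2 _ (IsCMField.complexConj_ne_one L) w hw hv (antidiagOne_isHermitian L 2)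
    (isUnit_placeForm_antidiagOne (E := L) 2 w.1) (unit_placeForm_antidiagOne_mem_glInt (E := L) 2 w.1) Λ]

include hw in
/-- **THE NORMALISED COUNT AT `w`** — ★ (L5-d3) `ncard_selfDualStable_smul_one_diag_eq_sum` at `F := L_w`, `σ := σ_w`, `ϖ := ι_w(ϖ_v)`: for `u₀, u₁ ∈ L_w` of norm one with
`|u₀ − u₁| = |ϖ^N|`, `↑γ′ = !![u₀, 0; 0, u₁]` and `e ∈ {0,1}`, `#S(ϖ^e • 1, γ′) = Σ_{j ≤ N, j ≡ e} w(j)` with `q = q_v = |𝓞_{L⁺} ∕ v|` (`|𝓀_w| = q_v²`, ★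
`natCard_residueField_eq_sq_of_inert`; `𝒪[L_w]` is a complete DVR with finite residue field by Mathlib; `σ_w` moves an integer by a unit — ★
`exists_isUnit_map_sub_of_residueHom_ne` over the `q_v`-Frobenius ★ `residueHom_galAdicCompletionMap_eq_pow`). [cite: Flicker1998UnitaryFL, §6 p. 95 + REMARK]
[cite: Serre1979, Ch. V §2 Prop. 3] -/
theorem ncard_selfDualStable_zpow_smul_one_eq_sum_at (hunr : Algebra.IsUnramifiedIn (𝓞 L) v.asIdeal) {u : Fin 2 → w.1.adicCompletion L}
    (hu1 : ∀ i, galAdicCompletionMap (L := L) (IsCMField.complexConj L) hw (u i) * u i = 1) {N : ℕ}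
    (hN : valuation (w.1.adicCompletion L) (u 0 - u 1) =
      valuation (w.1.adicCompletion L) (toPlace v w (GaloisRepresentations.HeckeCharacter.uniformizer ↥(maximalRealSubfield L) v : v.adicCompletion ↥(maximalRealSubfield L)) ^ N))
    {e : ℕ} (he : e ≤ 1) (γ' : GL (Fin 2) (w.1.adicCompletion L)) (hγ' : (γ' : Matrix (Fin 2) (Fin 2) (w.1.adicCompletion L)) = !![u 0, 0; 0, u 1]) :
    {Λ : Submodule 𝒪[w.1.adicCompletion L] (Fin 2 → w.1.adicCompletion L) |
        (∃ g : GL (Fin 2) (w.1.adicCompletion L),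
          (∃ J' ∈ glInt 2 (w.1.adicCompletion L), (J' : Matrix (Fin 2) (Fin 2) (w.1.adicCompletion L)) =
            formCongr (galAdicCompletionMap (L := L) (IsCMField.complexConj L) hw) g
              ((toPlace v w (GaloisRepresentations.HeckeCharacter.uniformizer ↥(maximalRealSubfield L) v : v.adicCompletion ↥(maximalRealSubfield L)) ^ (e : ℤ)) •
                (1 : Matrix (Fin 2) (Fin 2) (w.1.adicCompletion L)))) ∧
          Λ = Submodule.span 𝒪[w.1.adicCompletion L] (Set.range ((g : Matrix (Fin 2) (Fin 2) (w.1.adicCompletion L)))ᵀ)) ∧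
        Λ.map ((Matrix.toLin' ((γ' : GL (Fin 2) (w.1.adicCompletion L)) : Matrix (Fin 2) (Fin 2) (w.1.adicCompletion L))).restrictScalars
          𝒪[w.1.adicCompletion L]) = Λ}.ncard =
      ∑ j ∈ (range (N + 1)).filter (fun j => j % 2 = e),
        (if j = 0 then 1 else Nat.card (𝓞 ↥(maximalRealSubfield L) ⧸ v.asIdeal) ^ (j - 1) * (Nat.card (𝓞 ↥(maximalRealSubfield L) ⧸ v.asIdeal) + 1)) := by
  classical
  have hc1 : IsCMField.complexConj L ≠ 1 := IsCMField.complexConj_ne_one L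
  have hϖv := Liu2021.LemD1IndexedNonVacuityInertCofinite.valued_toPlace_uniformizer_of_isUnramifiedIn L v hunr w
  have hϖ : IsUniformizingElement
      (toPlace v w (GaloisRepresentations.HeckeCharacter.uniformizer ↥(maximalRealSubfield L) v : v.adicCompletion ↥(maximalRealSubfield L))) :=
    isUniformizingElement_of_v_eq hϖv
  haveI : IsDiscreteValuationRing 𝒪[w.1.adicCompletion L] := isDiscreteValuationRing_integer_of_compatible hϖv
  -- `σ_w` restricted to `𝒪`
  have hσO : ∀ x : 𝒪[w.1.adicCompletion L], galAdicCompletionMap (L := L) (IsCMField.complexConj L) hw x ∈ 𝒪[w.1.adicCompletion L] :=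
    mem_integer_galAdicCompletionMap (IsCMField.complexConj L) v w hw
  let σO : 𝒪[w.1.adicCompletion L] →+* 𝒪[w.1.adicCompletion L] :=
    ((galAdicCompletionMap (L := L) (IsCMField.complexConj L) hw).comp (𝒪[w.1.adicCompletion L]).subtype).codRestrict 𝒪[w.1.adicCompletion L] fun x => hσO x
  have hσO' : ∀ x : 𝒪[w.1.adicCompletion L], ((σO x : 𝒪[w.1.adicCompletion L]) : w.1.adicCompletion L) =
      galAdicCompletionMap (L := L) (IsCMField.complexConj L) hw x := fun _ => rfl
  have hσσ : ∀ x, σO (σO x) = x := fun x => Subtype.ext (galAdicCompletionMap_galAdicCompletionMap_of_smul_eq (IsCMField.complexConj L) w hc1 hw (x : w.1.adicCompletion L))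
  have hσϖ : galAdicCompletionMap (L := L) (IsCMField.complexConj L) hw
      (toPlace v w (GaloisRepresentations.HeckeCharacter.uniformizer ↥(maximalRealSubfield L) v : v.adicCompletion ↥(maximalRealSubfield L))) =
      toPlace v w (GaloisRepresentations.HeckeCharacter.uniformizer ↥(maximalRealSubfield L) v : v.adicCompletion ↥(maximalRealSubfield L)) :=
    galAdicCompletionMap_toPlace (IsCMField.complexConj L) w w hw _
  -- `σ_w` moves an integer by a unit (inert: `σ̄_w = Frob_q ≠ id`), `|𝓀_w| = q_v²`
  obtain ⟨σk, hσk⟩ := exists_residueField_ringHom_galAdicCompletionMap (IsCMField.complexConj L) v w hw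
  have hq : Nat.card 𝓀[w.1.adicCompletion L] = Nat.card (𝓞 ↥(maximalRealSubfield L) ⧸ v.asIdeal) ^ 2 :=
    natCard_residueField_eq_sq_of_inert (IsCMField.complexConj L) v hc1 hunr w hw
  letI : Fintype 𝓀[w.1.adicCompletion L] := Fintype.ofFinite _
  have hq' : Fintype.card 𝓀[w.1.adicCompletion L] = Nat.card (𝓞 ↥(maximalRealSubfield L) ⧸ v.asIdeal) ^ 2 := by rw [← Nat.card_eq_fintype_card, hq]
  obtain ⟨a₀, ha₀⟩ := LocalFields.UnramifiedQuadraticNorm.exists_isUnit_map_sub_of_residueHom_ne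
    (galAdicCompletionMap (L := L) (IsCMField.complexConj L) hw) hσO σk hσk
    (Literature.LinearAlgebra.Matrix.exists_frob_ne hq' σk (residueHom_galAdicCompletionMap_eq_pow (IsCMField.complexConj L) v hc1 hunr w hw σk hσO hσk))
  have ha₀' : IsUnit (σO a₀ - a₀) := ha₀
  -- the diagonal element as an element of `GL₂`
  have hval : ∀ i, valuation (w.1.adicCompletion L) (u i) = 1 := fun i => valuation_eq_one_of_galAdicCompletionMap_mul_self L v w hw (hu1 i)
  exact ncard_selfDualStable_smul_one_diag_eq_sum hϖ σO hσO' hσσ hσϖ he γ' hγ' (hval 0) (hval 1) hN ha₀' hq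

end OneClass

/-! ## §3 The value of ONE class, and the HEAD -/

omit [NumberField L] [IsCMField L] in
/-- `det Φ₂ ≠ 0` (`Φ₂ = antidiag(1,1)`). [cite: Rogawski1990, §3.1 p. 19] -/
private theorem det_antidiagTwo_ne_zero : ((Matrix.of fun i j : Fin 2 => if i.val + j.val + 1 = 2 then (1 : L) else 0)).det ≠ 0 := by
  rw [Matrix.det_fin_two]
  simp [Matrix.of_apply]

omit [IsCMField L] in
/-- `2 ≤ q_v = |𝓞_{L⁺} ∕ v|` (a residue ring of a number ring at a nonzero prime). [cite: NeukirchANT1999, Ch. I §3] -/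
private theorem two_le_natCard_quotient : 2 ≤ Nat.card (𝓞 ↥(maximalRealSubfield L) ⧸ v.asIdeal) := by
  classical
  haveI : Finite (𝓞 ↥(maximalRealSubfield L) ⧸ v.asIdeal) := Ideal.finiteQuotientOfFreeOfNeBot v.asIdeal v.ne_bot
  haveI : Nontrivial (𝓞 ↥(maximalRealSubfield L) ⧸ v.asIdeal) := Ideal.Quotient.nontrivial_iff.2 v.isPrime.ne_top
  exact Finite.one_lt_card

section Value

variable
  [MeasurableSpace ((cmDatum L 2 (Matrix.of fun i j : Fin 2 => if i.val + j.val + 1 = 2 then (1 : L) else 0)).Local v × (cmDatum L 1 (Matrix.of fun i j : Fin 1 => if i.val + j.val + 1 = 1 then (1 : L) else 0)).Local v)] [BorelSpace ((cmDatum L 2 (Matrix.of fun i j : Fin 2 => if i.val + j.val + 1 = 2 then (1 : L) else 0)).Local v × (cmDatum L 1 (Matrix.of fun i j : Fin 1 => if i.val + j.val + 1 = 1 then (1 : L) else 0)).Local v)]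
  [∀ a : (cmDatum L 2 (Matrix.of fun i j : Fin 2 => if i.val + j.val + 1 = 2 then (1 : L) else 0)).Local v × (cmDatum L 1 (Matrix.of fun i j : Fin 1 => if i.val + j.val + 1 = 1 then (1 : L) else 0)).Local v, MeasurableSpace (((cmDatum L 2 (Matrix.of fun i j : Fin 2 => if i.val + j.val + 1 = 2 then (1 : L) else 0)).Local v × (cmDatum L 1 (Matrix.of fun i j : Fin 1 => if i.val + j.val + 1 = 1 then (1 : L) else 0)).Local v) ⧸ Subgroup.centralizer ({a} : Set ((cmDatum L 2 (Matrix.of fun i j : Fin 2 => if i.val + j.val + 1 = 2 then (1 : L) else 0)).Local v × (cmDatum L 1 (Matrix.of fun i j : Fin 1 => if i.val + j.val + 1 = 1 then (1 : L) else 0)).Local v)))]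
  [∀ a : (cmDatum L 2 (Matrix.of fun i j : Fin 2 => if i.val + j.val + 1 = 2 then (1 : L) else 0)).Local v × (cmDatum L 1 (Matrix.of fun i j : Fin 1 => if i.val + j.val + 1 = 1 then (1 : L) else 0)).Local v, BorelSpace (((cmDatum L 2 (Matrix.of fun i j : Fin 2 => if i.val + j.val + 1 = 2 then (1 : L) else 0)).Local v × (cmDatum L 1 (Matrix.of fun i j : Fin 1 => if i.val + j.val + 1 = 1 then (1 : L) else 0)).Local v) ⧸ Subgroup.centralizer ({a} : Set ((cmDatum L 2 (Matrix.of fun i j : Fin 2 => if i.val + j.val + 1 = 2 then (1 : L) else 0)).Local v × (cmDatum L 1 (Matrix.of fun i j : Fin 1 => if i.val + j.val + 1 = 1 then (1 : L) else 0)).Local v)))]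
  (νH : Measure ((cmDatum L 2 (Matrix.of fun i j : Fin 2 => if i.val + j.val + 1 = 2 then (1 : L) else 0)).Local v × (cmDatum L 1 (Matrix.of fun i j : Fin 1 => if i.val + j.val + 1 = 1 then (1 : L) else 0)).Local v)) [νH.IsHaarMeasure] [νH.IsMulRightInvariant]

include hw in
/-- **THE VALUE OF ONE CLASS**: for `δ ∈ U(Φ₂)(L⁺_v)` with an eigenframe `δ Q = Q · diag(u)` on `E_v` (`u₀ ≠ u₁` of norm one, `|u₀ − u₁|_w = |ϖ^N|`), `Z(δ)` compact and
`(δ, γ₁)` `G`-regular, at a non-split `v` unramified in `L`, with `m_H` canonical and `ν_H(K₂ ×ˢ K₁) = 1`: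
`Φ(⟦(δ, γ₁)⟧, 1_{K₂ ×ˢ K₁}) = Σ_{j ≤ N, j ≡ e} w(j)` for an `e ∈ {0, 1}` with `e = 0 ⟺` the order of `⟨q₀, q₀⟩` at `w` is even (★ (L2)-PAIR ∘ ★ lattice count ∘
★ (L5-d1) ∘ ★ (L5-d3)). [cite: Flicker1998UnitaryFL, §6 p. 95] [cite: Rogawski1990, §4.9 Prop. 4.9.1 (b) p. 55] [cite: Kottwitz1986, §3] -/
theorem exists_classOrbitalIntegral_indicator_eq_paritySum (hunr : Algebra.IsUnramifiedIn (𝓞 L) v.asIdeal)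
    {mH : OrbitalMeasureFamily ((cmDatum L 2 (Matrix.of fun i j : Fin 2 => if i.val + j.val + 1 = 2 then (1 : L) else 0)).Local v × (cmDatum L 1 (Matrix.of fun i j : Fin 1 => if i.val + j.val + 1 = 1 then (1 : L) else 0)).Local v)} (hmH : mH.IsCanonical (IsLocalGRegular L v) νH)
    (hνH : νH (((cmLocalIntegralLevel L 2 (Matrix.of fun i j : Fin 2 => if i.val + j.val + 1 = 2 then (1 : L) else 0) v).prod (cmLocalIntegralLevel L 1 (Matrix.of fun i j : Fin 1 => if i.val + j.val + 1 = 1 then (1 : L) else 0) v) : Subgroup ((cmDatum L 2 (Matrix.of fun i j : Fin 2 => if i.val + j.val + 1 = 2 then (1 : L) else 0)).Local v × (cmDatum L 1 (Matrix.of fun i j : Fin 1 => if i.val + j.val + 1 = 1 then (1 : L) else 0)).Local v)) : Set ((cmDatum L 2 (Matrix.of fun i j : Fin 2 => if i.val + j.val + 1 = 2 then (1 : L) else 0)).Local v × (cmDatum L 1 (Matrix.of fun i j : Fin 1 => if i.val + j.val + 1 = 1 then (1 : L) else 0)).Local v)) = 1)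
    (δ : (cmDatum L 2 (Matrix.of fun i j : Fin 2 => if i.val + j.val + 1 = 2 then (1 : L) else 0)).Local v) (γ₁ : (cmDatum L 1 (Matrix.of fun i j : Fin 1 => if i.val + j.val + 1 = 1 then (1 : L) else 0)).Local v) (hγ : IsLocalGRegular L v (δ, γ₁))
    [CompactSpace (Subgroup.centralizer ({δ} : Set ((cmDatum L 2 (Matrix.of fun i j : Fin 2 => if i.val + j.val + 1 = 2 then (1 : L) else 0)).Local v)))]
    {Q : GL (Fin 2) (LocalRing L v)} {u : Fin 2 → LocalRing L v}
    (hQ : δ.val.val * Q.val = Q.val * diagonal u)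
    (hu : Function.Injective u) (hu1 : ∀ i, conjLocal L (IsCMField.complexConj L) v (u i) * u i = 1) {N : ℕ}
    (hN : valuation (w.1.adicCompletion L) (u 0 w - u 1 w) = valuation (w.1.adicCompletion L) ((toPlace v w (GaloisRepresentations.HeckeCharacter.uniformizer ↥(maximalRealSubfield L) v : v.adicCompletion ↥(maximalRealSubfield L))) ^ N)) :
    ∃ e : ℕ, e ≤ 1 ∧
      (Even (WithZero.log (Valued.v ((twistGram (conjLocal L (IsCMField.complexConj L) v) ((adelicForm L 2 (Matrix.of fun i j : Fin 2 => if i.val + j.val + 1 = 2 then (1 : L) else 0)).map (adeleToLocal L v)) Q.val 0 0) w))) ↔ e = 0) ∧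
      classOrbitalIntegral mH ((((cmLocalIntegralLevel L 2 (Matrix.of fun i j : Fin 2 => if i.val + j.val + 1 = 2 then (1 : L) else 0) v).prod (cmLocalIntegralLevel L 1 (Matrix.of fun i j : Fin 1 => if i.val + j.val + 1 = 1 then (1 : L) else 0) v) : Subgroup ((cmDatum L 2 (Matrix.of fun i j : Fin 2 => if i.val + j.val + 1 = 2 then (1 : L) else 0)).Local v × (cmDatum L 1 (Matrix.of fun i j : Fin 1 => if i.val + j.val + 1 = 1 then (1 : L) else 0)).Local v)) : Set ((cmDatum L 2 (Matrix.of fun i j : Fin 2 => if i.val + j.val + 1 = 2 then (1 : L) else 0)).Local v × (cmDatum L 1 (Matrix.of fun i j : Fin 1 => if i.val + j.val + 1 = 1 then (1 : L) else 0)).Local v)).indicator fun _ => (1 : ℂ)) (ConjClasses.mk (δ, γ₁)) =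
        ((∑ j ∈ (range (N + 1)).filter (fun j => j % 2 = e), (if j = 0 then 1 else Nat.card (𝓞 ↥(maximalRealSubfield L) ⧸ v.asIdeal) ^ (j - 1) * (Nat.card (𝓞 ↥(maximalRealSubfield L) ⧸ v.asIdeal) + 1)) : ℕ) : ℂ) := by
  have hc1 : IsCMField.complexConj L ≠ 1 := IsCMField.complexConj_ne_one L
  -- the one-place data
  have hδw : (((localNonsplitEquiv (IsCMField.complexConj L) (Matrix.of fun i j : Fin 2 => if i.val + j.val + 1 = 2 then (1 : L) else 0) hc1 w hw δ :
      unitaryGroupOfForm (galAdicCompletionMap (L := L) (IsCMField.complexConj L) hw) (placeForm (Matrix.of fun i j : Fin 2 => if i.val + j.val + 1 = 2 then (1 : L) else 0) w.1)) :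
        GL (Fin 2) (w.1.adicCompletion L)) ∈
      Literature.AlgebraicGeometry.ShimuraVarieties.unitaryGroup (galAdicCompletionMap (L := L) (IsCMField.complexConj L) hw) (placeForm (Matrix.of fun i j : Fin 2 => if i.val + j.val + 1 = 2 then (1 : L) else 0) w.1)) :=
    Literature.AlgebraicGeometry.ShimuraVarieties.mem_unitaryGroup_iff.2
      (mem_unitaryGroupOfForm_iff.1 (localNonsplitEquiv (IsCMField.complexConj L) (Matrix.of fun i j : Fin 2 => if i.val + j.val + 1 = 2 then (1 : L) else 0) hc1 w hw δ).2)
  have hQw : (((localNonsplitEquiv (IsCMField.complexConj L) (Matrix.of fun i j : Fin 2 => if i.val + j.val + 1 = 2 then (1 : L) else 0) hc1 w hw δ :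
      unitaryGroupOfForm (galAdicCompletionMap (L := L) (IsCMField.complexConj L) hw) (placeForm (Matrix.of fun i j : Fin 2 => if i.val + j.val + 1 = 2 then (1 : L) else 0) w.1)) :
        GL (Fin 2) (w.1.adicCompletion L)) : Matrix (Fin 2) (Fin 2) (w.1.adicCompletion L)) *
        (Matrix.GeneralLinearGroup.map (Pi.evalRingHom (fun w' : PlacesOver L v => w'.1.adicCompletion L) w) Q :
          Matrix (Fin 2) (Fin 2) (w.1.adicCompletion L)) =
      (Matrix.GeneralLinearGroup.map (Pi.evalRingHom (fun w' : PlacesOver L v => w'.1.adicCompletion L) w) Q :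
          Matrix (Fin 2) (Fin 2) (w.1.adicCompletion L)) * diagonal fun i => u i w := by
    rw [coe_localNonsplitEquiv_apply L (Matrix.of fun i j : Fin 2 => if i.val + j.val + 1 = 2 then (1 : L) else 0) v w hw δ]
    exact map_eval_mul_eq_of_eigenframe L v w hQ
  obtain ⟨huw, hu1w⟩ := injective_eval_and_norm_one_of_eigenvalues L v w hw hu hu1
  obtain ⟨e, γ', he, hpar, hγ', hS⟩ := exists_ncard_selfDualStable_antidiagTwo_eq_zpow_smul_one L v w hw hunr hδw hQw huw hu1w
  -- parity currency: one-place `twistGram` = CM `twistGram` read at `w`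
  have hpf : twistGram (galAdicCompletionMap (L := L) (IsCMField.complexConj L) hw) (placeForm (Matrix.of fun i j : Fin 2 => if i.val + j.val + 1 = 2 then (1 : L) else 0) w.1)
      (Matrix.GeneralLinearGroup.map (Pi.evalRingHom (fun w' : PlacesOver L v => w'.1.adicCompletion L) w) Q).val 0 0 =
      (twistGram (conjLocal L (IsCMField.complexConj L) v) ((adelicForm L 2 (Matrix.of fun i j : Fin 2 => if i.val + j.val + 1 = 2 then (1 : L) else 0)).map (adeleToLocal L v)) Q.val 0 0) w := by
    rw [← localForm_map_eval L 2 (Matrix.of fun i j : Fin 2 => if i.val + j.val + 1 = 2 then (1 : L) else 0) v w]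
    exact (twistGram_apply_eval L v w hw _ _ 0 0).symm
  refine ⟨e, he, by rw [← hpf]; exact hpar, ?_⟩
  refine (classOrbitalIntegral_indicator_complex_cmLocalIntegralLevel_prod_eq_natCard_fixedBy_fst L v νH hmH hνH (δ, γ₁) hγ w hw).trans ?_
  rw [natCard_fixedBy_eq_ncard_selfDualStable_antidiagTwo L v w hw hunr δ, hS,
    ncard_selfDualStable_zpow_smul_one_eq_sum_at L v w hw hunr hu1w hN he γ' hγ']

include hw in
/-- **THE H-SIDE VALUE OF THE INERT UNIT FUNDAMENTAL LEMMA (Flicker 1998, §6 p. 95): `Φ^st(γ_H, 1_{K_H}) = (q^N(q+1) − 2)∕(q − 1)`.**  At a finite place `v` of `L⁺`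
NON-SPLIT (`c • w = w`) and UNRAMIFIED in `L`, on `H_v = U(Φ₂)(L⁺_v) × U(Φ₁)(L⁺_v)` with `m_H` canonical for `(IsLocalGRegular, ν_H)` and `ν_H(K₂ ×ˢ K₁) = 1`: for
`γ_H = (γ₂, γ₁)` `G`-regular with `γ₂` ELLIPTIC REGULAR OF TYPE (1) — an eigenframe `γ₂ P = P · diag(u)` over `E_v = L ⊗ L⁺_v` with `u₀ ≠ u₁` of norm one (★ (L5-e)
currency), `Z(γ₂)` compact — and `N := v_w(u₀ − u₁)` (`|u₀ − u₁|_w = |ϖ^N|`), `q = q_v = |𝓞_{L⁺}∕v|`: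
`stableOrbitalIntegralRel (IsLocalStablyConjH L v) m_H 1_{K₂ ×ˢ K₁} (γ₂, γ₁) = ((q^N (q+1) − 2) ∕ (q − 1) : ℂ)`.
The stable class of `γ_H` is `⟦(γ₂, γ₁)⟧ ⊔ ⟦(γ₂′, γ₁)⟧` (★ (L5-e) A-p13: Flicker's `t₁, t₂`), the two class orbital integrals are the self-dual `γ`-stable lattice counts
(★ (L2)-PAIR ∘ ★ lattice-count socket), transported to an eigenframe with Gram matrix `ϖ^e · 1` (★ (L5-d1) A-p13) where they are the EVEN and ODD gluing sums
`Σ_{j ≤ N, j ≡ e} w(j)`, `w(0) = 1`, `w(j) = q^{j−1}(q+1)` (★ (L5-d3) over ★ (L5-a) Hermite forms, ★ (L5-b) B-p04 self-duality, ★ (L5-c) norm fibres) — the two parities differ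
(★ (L5-d1) parity flip on the failed norm test) — and `Σ_{j ≤ N} w(j) = (q^N(q+1) − 2)∕(q − 1)` (★ (L5-d2) ∘ ★ HEAD SKELETON p840679).
BINDERS LEFT, NAMED: `hcpt` — the centraliser of the second class `γ₂′` is compact too (both are the anisotropic torus `T(L⁺_v)`; the tree has no torus-transfer
of compactness yet) — and `hreg` — `G`-regularity of `(γ₂′, γ₁)` (a function of the eigenvalues, which `γ₂′` shares with `γ₂`).
[cite: Flicker1998UnitaryFL, §6 p. 95] [cite: Rogawski1990, §4.9 Prop. 4.9.1 (b) p. 55, Lemma 4.9.3 p. 56] [cite: Kottwitz1986, §3] -/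
theorem stableOrbitalIntegralRel_indicator_eq_flicker_of_eigenframe (hunr : Algebra.IsUnramifiedIn (𝓞 L) v.asIdeal)
    {mH : OrbitalMeasureFamily ((cmDatum L 2 (Matrix.of fun i j : Fin 2 => if i.val + j.val + 1 = 2 then (1 : L) else 0)).Local v × (cmDatum L 1 (Matrix.of fun i j : Fin 1 => if i.val + j.val + 1 = 1 then (1 : L) else 0)).Local v)} (hmH : mH.IsCanonical (IsLocalGRegular L v) νH)
    (hνH : νH (((cmLocalIntegralLevel L 2 (Matrix.of fun i j : Fin 2 => if i.val + j.val + 1 = 2 then (1 : L) else 0) v).prod (cmLocalIntegralLevel L 1 (Matrix.of fun i j : Fin 1 => if i.val + j.val + 1 = 1 then (1 : L) else 0) v) : Subgroup ((cmDatum L 2 (Matrix.of fun i j : Fin 2 => if i.val + j.val + 1 = 2 then (1 : L) else 0)).Local v × (cmDatum L 1 (Matrix.of fun i j : Fin 1 => if i.val + j.val + 1 = 1 then (1 : L) else 0)).Local v)) : Set ((cmDatum L 2 (Matrix.of fun i j : Fin 2 => if i.val + j.val + 1 = 2 then (1 : L) else 0)).Local v × (cmDatum L 1 (Matrix.of fun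 i j : Fin 1 => if i.val + j.val + 1 = 1 then (1 : L) else 0)).Local v)) = 1)
    (γ₂ : (cmDatum L 2 (Matrix.of fun i j : Fin 2 => if i.val + j.val + 1 = 2 then (1 : L) else 0)).Local v) (γ₁ : (cmDatum L 1 (Matrix.of fun i j : Fin 1 => if i.val + j.val + 1 = 1 then (1 : L) else 0)).Local v) (hγ : IsLocalGRegular L v (γ₂, γ₁))
    [CompactSpace (Subgroup.centralizer ({γ₂} : Set ((cmDatum L 2 (Matrix.of fun i j : Fin 2 => if i.val + j.val + 1 = 2 then (1 : L) else 0)).Local v)))]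
    {P : GL (Fin 2) (LocalRing L v)} {u : Fin 2 → LocalRing L v}
    (hP : γ₂.val.val * P.val = P.val * diagonal u)
    (hu : Function.Injective u) (hu1 : ∀ i, conjLocal L (IsCMField.complexConj L) v (u i) * u i = 1) {N : ℕ}
    (hN : valuation (w.1.adicCompletion L) (u 0 w - u 1 w) = valuation (w.1.adicCompletion L) ((toPlace v w (GaloisRepresentations.HeckeCharacter.uniformizer ↥(maximalRealSubfield L) v : v.adicCompletion ↥(maximalRealSubfield L))) ^ N))
    (hcpt : ∀ δ : (cmDatum L 2 (Matrix.of fun i j : Fin 2 => if i.val + j.val + 1 = 2 then (1 : L) else 0)).Local v, IsStablyConj (conjLocal L (IsCMField.complexConj L) v) ((adelicForm L 2 (Matrix.of fun i j : Fin 2 => if i.val + j.val + 1 = 2 then (1 : L) else 0)).map (adeleToLocal L v)) γ₂ δ →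
      CompactSpace (Subgroup.centralizer ({δ} : Set ((cmDatum L 2 (Matrix.of fun i j : Fin 2 => if i.val + j.val + 1 = 2 then (1 : L) else 0)).Local v))))
    (hreg : ∀ δ : (cmDatum L 2 (Matrix.of fun i j : Fin 2 => if i.val + j.val + 1 = 2 then (1 : L) else 0)).Local v, IsStablyConj (conjLocal L (IsCMField.complexConj L) v) ((adelicForm L 2 (Matrix.of fun i j : Fin 2 => if i.val + j.val + 1 = 2 then (1 : L) else 0)).map (adeleToLocal L v)) γ₂ δ → IsLocalGRegular L v (δ, γ₁)) :
    stableOrbitalIntegralRel (IsLocalStablyConjH L v) mH ((((cmLocalIntegralLevel L 2 (Matrix.of fun i j : Fin 2 => if i.val + j.val + 1 = 2 then (1 : L) else 0) v).prod (cmLocalIntegralLevel L 1 (Matrix.of fun i j : Fin 1 => if i.val + j.val + 1 = 1 then (1 : L) else 0) v) : Subgroup ((cmDatum L 2 (Matrix.of fun i j : Fin 2 => if i.val + j.val + 1 = 2 then (1 : L) else 0)).Local v × (cmDatum L 1 (Matrix.of fun i j : Fin 1 => if i.val + j.val + 1 = 1 then (1 : L) else 0)).Local v)) : Set ((cmDatum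 L 2 (Matrix.of fun i j : Fin 2 => if i.val + j.val + 1 = 2 then (1 : L) else 0)).Local v × (cmDatum L 1 (Matrix.of fun i j : Fin 1 => if i.val + j.val + 1 = 1 then (1 : L) else 0)).Local v)).indicator fun _ => (1 : ℂ)) (γ₂, γ₁) =
      ((Nat.card (𝓞 ↥(maximalRealSubfield L) ⧸ v.asIdeal) : ℂ) ^ N * (Nat.card (𝓞 ↥(maximalRealSubfield L) ⧸ v.asIdeal) + 1) - 2) / (Nat.card (𝓞 ↥(maximalRealSubfield L) ⧸ v.asIdeal) - 1) := by
  have hc1 : IsCMField.complexConj L ≠ 1 := IsCMField.complexConj_ne_one L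
  have hH : ((((adelicForm L 2 (Matrix.of fun i j : Fin 2 => if i.val + j.val + 1 = 2 then (1 : L) else 0)).map (adeleToLocal L v))).map (conjLocal L (IsCMField.complexConj L) v))ᵀ = ((adelicForm L 2 (Matrix.of fun i j : Fin 2 => if i.val + j.val + 1 = 2 then (1 : L) else 0)).map (adeleToLocal L v)) :=
    map_conjLocal_transpose_localForm L 2 (Matrix.of fun i j : Fin 2 => if i.val + j.val + 1 = 2 then (1 : L) else 0) v (antidiagOne_isHermitian L 2)
  have hHd : IsUnit (((adelicForm L 2 (Matrix.of fun i j : Fin 2 => if i.val + j.val + 1 = 2 then (1 : L) else 0)).map (adeleToLocal L v))).det := isUnit_det_localForm L 2 (Matrix.of fun i j : Fin 2 => if i.val + j.val + 1 = 2 then (1 : L) else 0) v (det_antidiagTwo_ne_zero L)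
  have hγ₂ : γ₂.val ∈ Literature.AlgebraicGeometry.ShimuraVarieties.unitaryGroup (conjLocal L (IsCMField.complexConj L) v) ((adelicForm L 2 (Matrix.of fun i j : Fin 2 => if i.val + j.val + 1 = 2 then (1 : L) else 0)).map (adeleToLocal L v)) :=
    Literature.AlgebraicGeometry.ShimuraVarieties.mem_unitaryGroup_iff.2 (mem_unitaryGroupOfForm_iff.1 γ₂.2)
  -- ★ (L5-e): the second class
  obtain ⟨g, hg, hT, hst, hnc, hall⟩ := exists_isStablyConj_not_isConj_forall_isConj_or_rankTwo L v (IsCMField.complexConj L)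
    (GelbartRogawski1991.UnitaryDualPair.complexConj_imagUnit L) (GelbartRogawski1991.UnitaryDualPair.imagUnit_ne_zero L) w hw hH hHd hγ₂ hP hu hu1
  have hg' : g * γ₂.val * g⁻¹ ∈ UnitaryGroup.«local» L (IsCMField.complexConj L) 2 (Matrix.of fun i j : Fin 2 => if i.val + j.val + 1 = 2 then (1 : L) else 0) v :=
    mem_unitaryGroupOfForm_iff.2 (Literature.AlgebraicGeometry.ShimuraVarieties.mem_unitaryGroup_iff.1 hg)
  set γ₂' : (cmDatum L 2 (Matrix.of fun i j : Fin 2 => if i.val + j.val + 1 = 2 then (1 : L) else 0)).Local v := ⟨g * γ₂.val * g⁻¹, hg'⟩ with hγ₂'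
  have hst' : IsStablyConj (conjLocal L (IsCMField.complexConj L) v) ((adelicForm L 2 (Matrix.of fun i j : Fin 2 => if i.val + j.val + 1 = 2 then (1 : L) else 0)).map (adeleToLocal L v)) γ₂ γ₂' := hst
  have hnc' : ¬ IsConj γ₂ γ₂' := hnc
  have hall' : ∀ δ : (cmDatum L 2 (Matrix.of fun i j : Fin 2 => if i.val + j.val + 1 = 2 then (1 : L) else 0)).Local v, IsStablyConj (conjLocal L (IsCMField.complexConj L) v) ((adelicForm L 2 (Matrix.of fun i j : Fin 2 => if i.val + j.val + 1 = 2 then (1 : L) else 0)).map (adeleToLocal L v)) γ₂ δ → IsConj γ₂ δ ∨ IsConj γ₂' δ := hall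
  -- the eigenframe of the second class: `(g γ₂ g⁻¹)(g P) = (g P) diag(u)`
  have hP' : γ₂'.val.val * (g * P).val = (g * P).val * diagonal u := by
    show (g * γ₂.val * g⁻¹).val * (g * P).val = (g * P).val * diagonal u
    rw [Units.val_mul, Units.val_mul, Units.val_mul, Matrix.mul_assoc (g.val * γ₂.val.val), ← Matrix.mul_assoc (g⁻¹).val,
      Units.inv_mul, Matrix.one_mul, Matrix.mul_assoc, hP, ← Matrix.mul_assoc]
  haveI : CompactSpace (Subgroup.centralizer ({γ₂'} : Set ((cmDatum L 2 (Matrix.of fun i j : Fin 2 => if i.val + j.val + 1 = 2 then (1 : L) else 0)).Local v))) := hcpt γ₂' hst'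
  -- the two class values
  obtain ⟨e₀, he₀, hpar₀, h₀⟩ := exists_classOrbitalIntegral_indicator_eq_paritySum L v w hw νH hunr hmH hνH γ₂ γ₁ hγ hP hu hu1 hN
  obtain ⟨e₁, he₁, hpar₁, h₁⟩ := exists_classOrbitalIntegral_indicator_eq_paritySum L v w hw νH hunr hmH hνH γ₂' γ₁ (hreg γ₂' hst') hP' hu hu1 hN
  -- the parity flip: `e₁ ≠ e₀`
  have hflip := even_log_twistGram_apply_iff_not_of_not_normTest L v w hw hunr hH hHd hγ₂ hP hu hu1 hg hT
  have hval' : (g * P).val = g.val * P.val := Units.val_mul _ _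
  rw [hval'] at hpar₁
  have hiff : e₁ = 0 ↔ ¬ e₀ = 0 := hpar₁.symm.trans (hflip.trans (not_congr hpar₀))
  have hsum : e₀ + e₁ = 1 := by
    rcases Nat.eq_zero_or_pos e₀ with h0 | h0
    · have h1 : e₁ ≠ 0 := fun h1 => (hiff.1 h1) h0
      omega
    · have h1 : e₁ = 0 := hiff.2 (by omega)
      omega
  have hS : (∑ j ∈ (range (N + 1)).filter (fun j => j % 2 = e₀), (if j = 0 then 1 else Nat.card (𝓞 ↥(maximalRealSubfield L) ⧸ v.asIdeal) ^ (j - 1) * (Nat.card (𝓞 ↥(maximalRealSubfield L) ⧸ v.asIdeal) + 1))) +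
      (∑ j ∈ (range (N + 1)).filter (fun j => j % 2 = e₁), (if j = 0 then 1 else Nat.card (𝓞 ↥(maximalRealSubfield L) ⧸ v.asIdeal) ^ (j - 1) * (Nat.card (𝓞 ↥(maximalRealSubfield L) ⧸ v.asIdeal) + 1))) =
      ∑ j ∈ range (N + 1), (if j = 0 then 1 else Nat.card (𝓞 ↥(maximalRealSubfield L) ⧸ v.asIdeal) ^ (j - 1) * (Nat.card (𝓞 ↥(maximalRealSubfield L) ⧸ v.asIdeal) + 1)) := by
    rcases Nat.eq_zero_or_pos e₀ with h0 | h0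
    · have h1 : e₁ = 1 := by omega
      rw [h0, h1]; exact even_add_odd_gluingSum_eq _ N
    · have h0' : e₀ = 1 := by omega
      have h1 : e₁ = 0 := by omega
      rw [h0', h1]; exact odd_add_even_gluingSum_eq _ N
  exact stableOrbitalIntegralRel_indicator_eq_div_of_two_classes_of_values L v mH _ γ₂ γ₂' γ₁ hst' hnc' hall'
    (two_le_natCard_quotient L v) N h₀ h₁ hS

include hw in
/-- **(S1) OF THE «N7nsCount» ASSEMBLY CONTRACT** (A-p06 (g26) SPEC-F12 a2a01283): the same value in the closed-form currency ★ `Flicker1998.phiH` with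
`q := Ideal.absNorm v.asIdeal` — `Φ^st(γ_H, 1_{K_H}) = ((phiH q N : ℚ) : ℂ)`. [cite: Flicker1998UnitaryFL, §6 p. 95] -/
theorem stableOrbitalIntegralRel_indicator_eq_phiH_of_eigenframe (hunr : Algebra.IsUnramifiedIn (𝓞 L) v.asIdeal)
    {mH : OrbitalMeasureFamily ((cmDatum L 2 (Matrix.of fun i j : Fin 2 => if i.val + j.val + 1 = 2 then (1 : L) else 0)).Local v × (cmDatum L 1 (Matrix.of fun i j : Fin 1 => if i.val + j.val + 1 = 1 then (1 : L) else 0)).Local v)} (hmH : mH.IsCanonical (IsLocalGRegular L v) νH)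
    (hνH : νH (((cmLocalIntegralLevel L 2 (Matrix.of fun i j : Fin 2 => if i.val + j.val + 1 = 2 then (1 : L) else 0) v).prod (cmLocalIntegralLevel L 1 (Matrix.of fun i j : Fin 1 => if i.val + j.val + 1 = 1 then (1 : L) else 0) v) : Subgroup ((cmDatum L 2 (Matrix.of fun i j : Fin 2 => if i.val + j.val + 1 = 2 then (1 : L) else 0)).Local v × (cmDatum L 1 (Matrix.of fun i j : Fin 1 => if i.val + j.val + 1 = 1 then (1 : L) else 0)).Local v)) : Set ((cmDatum L 2 (Matrix.of fun i j : Fin 2 => if i.val + j.val + 1 = 2 then (1 : L) else 0)).Local v × (cmDatum L 1 (Matrix.of fun i j : Fin 1 => if i.val + j.val + 1 = 1 then (1 : L) else 0)).Local v)) = 1)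
    (γ₂ : (cmDatum L 2 (Matrix.of fun i j : Fin 2 => if i.val + j.val + 1 = 2 then (1 : L) else 0)).Local v) (γ₁ : (cmDatum L 1 (Matrix.of fun i j : Fin 1 => if i.val + j.val + 1 = 1 then (1 : L) else 0)).Local v) (hγ : IsLocalGRegular L v (γ₂, γ₁))
    [CompactSpace (Subgroup.centralizer ({γ₂} : Set ((cmDatum L 2 (Matrix.of fun i j : Fin 2 => if i.val + j.val + 1 = 2 then (1 : L) else 0)).Local v)))]
    {P : GL (Fin 2) (LocalRing L v)} {u : Fin 2 → LocalRing L v}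
    (hP : γ₂.val.val * P.val = P.val * diagonal u)
    (hu : Function.Injective u) (hu1 : ∀ i, conjLocal L (IsCMField.complexConj L) v (u i) * u i = 1) {N : ℕ}
    (hN : valuation (w.1.adicCompletion L) (u 0 w - u 1 w) = valuation (w.1.adicCompletion L) ((toPlace v w (GaloisRepresentations.HeckeCharacter.uniformizer ↥(maximalRealSubfield L) v : v.adicCompletion ↥(maximalRealSubfield L))) ^ N))
    (hcpt : ∀ δ : (cmDatum L 2 (Matrix.of fun i j : Fin 2 => if i.val + j.val + 1 = 2 then (1 : L) else 0)).Local v, IsStablyConj (conjLocal L (IsCMField.complexConj L) v) ((adelicForm L 2 (Matrix.of fun i j : Fin 2 => if i.val + j.val + 1 = 2 then (1 : L) else 0)).map (adeleToLocal L v)) γ₂ δ →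
      CompactSpace (Subgroup.centralizer ({δ} : Set ((cmDatum L 2 (Matrix.of fun i j : Fin 2 => if i.val + j.val + 1 = 2 then (1 : L) else 0)).Local v))))
    (hreg : ∀ δ : (cmDatum L 2 (Matrix.of fun i j : Fin 2 => if i.val + j.val + 1 = 2 then (1 : L) else 0)).Local v, IsStablyConj (conjLocal L (IsCMField.complexConj L) v) ((adelicForm L 2 (Matrix.of fun i j : Fin 2 => if i.val + j.val + 1 = 2 then (1 : L) else 0)).map (adeleToLocal L v)) γ₂ δ → IsLocalGRegular L v (δ, γ₁)) :
    stableOrbitalIntegralRel (IsLocalStablyConjH L v) mH ((((cmLocalIntegralLevel L 2 (Matrix.of fun i j : Fin 2 => if i.val + j.val + 1 = 2 then (1 : L) else 0) v).prod (cmLocalIntegralLevel L 1 (Matrix.of fun i j : Fin 1 => if i.val + j.val + 1 = 1 then (1 : L) else 0) v) : Subgroup ((cmDatum L 2 (Matrix.of fun i j : Fin 2 => if i.val + j.val + 1 = 2 then (1 : L) else 0)).Local v × (cmDatum L 1 (Matrix.of fun i j : Fin 1 => if i.val + j.val + 1 = 1 then (1 : L) else 0)).Local v)) : Set ((cmDatum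 L 2 (Matrix.of fun i j : Fin 2 => if i.val + j.val + 1 = 2 then (1 : L) else 0)).Local v × (cmDatum L 1 (Matrix.of fun i j : Fin 1 => if i.val + j.val + 1 = 1 then (1 : L) else 0)).Local v)).indicator fun _ => (1 : ℂ)) (γ₂, γ₁) =
      ((Flicker1998.phiH (Ideal.absNorm v.asIdeal) N : ℚ) : ℂ) := by
  rw [stableOrbitalIntegralRel_indicator_eq_flicker_of_eigenframe L v w hw νH hunr hmH hνH γ₂ γ₁ hγ hP hu hu1 hN hcpt hreg,
    Flicker1998.phiH, Ideal.absNorm_apply, Submodule.cardQuot_apply]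
  push_cast
  ring

end Value

end Literature.NumberTheory.Automorphic.UnitaryGroup

end
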